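import Summits.ABC.IUTFork.Conditional.AbcOfSlotLicenceGenuineKContent
import Summits.ABC.IUTFork.Conditional.AbcOfSGenuineMWindowContent
import Summits.ABC.IUTFork.Cor312PilotIdelesMNumbersSummand
import HarnessLib

/-!
# Branch C, M line, READING (P) — the γ certificates AT THE SUMMAND-ROUTE M-LEVEL GENUINE SHARP SETTING of every datum: `ABC` ⟸ [per admissible
# datum: WHEREVER the SLOT licence FAILS, the PER-IMAGE number-level Corollary] + the per-image Θ-side READ-P-M; NO CONE BINDER, NO PROVENANCE BINDER
# (M twins of abc-iut-C-cert-2's `abc_of_slotLicence_orNumP_K_szpiroBad` p458998 and abc-iut-C-cert-1's θ-cut `abc_of_slotLicence_orNumP_K_content` p461361)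

C scoreboard (abc-iut-C-cert-1 gen 5, EVEN-revision writer; abc-iut-C-cert-2 gen 3's HANDOFF open item (3) «M-line γ/joint twins», its gen 4 supplies the
M-LEVEL SLOT READ `Cor312ThetaSlotM*` that discharges `hReadP` below). PROOF-ONLY (no `def`, no new `Prop`, no instance, no notation; nothing re-typed).
The reading-(P) vocabulary `thetaSlotHull` / `SlotLicence` / `negLogThetaSlot` / `SlotStatement` is abc-iut-C-cert-2's `Cor312SlotHull.lean` (p458847) over
ANY `Cor312.Setting`; here it is read at the M books' VERBATIM setting term — abc-iut-s2-p8's summand-route M-level sharp setting `settingPrVolSharpM` (carriers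
the genuine completions `K_{v̲}`, `v̲ ∈ V̲`, [IUTchI] Def. 3.1 (e)) with the pilot regions read off the datum's OWN ideles (abc-iut-w5-d033 `tOfIdeleData` /
`tqM` of `ideleDataOf T.D T.isVolumeInputOf`), exactly as in the M records `abc_of_SH_v11M_window_szpiroBadAll` (p453767) / `abc_of_SH_v11M_window_content`
(p461893). DATA binders = those files' VERBATIM (the S_H-only columns `frob*` / `unitImage` / `ballImage` / `thetaDiv` / `qK` are not needed on the γ line).

* `GenuineMSlot.cor312PerImageOf_of_slotStatement` — per genuine datum `T`: `SlotStatement` + the READ-P-M bound `negLogThetaSlot ≤ ↑T.negLogThetaPerImage`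
  ⟹ `T.Cor312PerImageOf`; the q-side is abc-iut-w5-d244's THEOREM `negLogQ_settingPrVolSharpM_ideleDataOf_eq_negAbsLogQ` (p440575: `−|log(q)| = I.negAbsLogQ`
  at the datum's own `q`-ideles — NO provenance binder, unlike the K line's `absLogq` detour);
* `GenuineMSlot.cor312PerImageOf_of_slotLicence` — the same from `SlotLicence` (monotone log-volume = abc-iut-s2-p8's THEOREM
  `bridgeHyps_settingPrVolSharpM_of_ideles …|>.mono`, p438078, side conditions abc-iut-w5-d033 `tThetaM_ne_zero` / `norm_tThetaM_eq_one_of_not_mem`;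
  finiteness of `−|log(Θ)|_(P)` from the READ-P-M bound itself; then `Cor312.Setting.slotStatement_of_slotLicence`);
* **`abc_of_slotLicence_orNumP_M_szpiroBad`** — [NUM-P-OFF-M, Szpiro-bad] `hNumPOffBad` «at every admissible SZPIRO-BAD `(P, l)` and genuine `T` at which
  OUR SLOT licence FAILS at the M-level setting, `T.Cor312PerImageOf`» · [READ-P-M] `hReadP` «at every genuine `T`, `negLogThetaSlot (M-level setting) ≤
  ↑T.negLogThetaPerImage`». Tail abc-iut-c312-d1 `Cor22.forall_cor312PerImageOf_of_szpiroBad` + abc-iut-S2 `ABC_of_cor312PerImage` (p458998's, verbatim);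
* **`abc_of_slotLicence_orNumP_M_content`** — the θ-cut: the Szpiro-bad antecedent REPLACED by the content guard of [IUTchIV] Thm. 1.10's display
  «`6·(1 + 20·d_mod/l)·(log-diff + log-cond) + 120·d*_mod·l < log q^{∤{2,l}}(λ)`» (implies Szpiro-bad: `szpiroBad_of_content`; WEAKER-OR-EQUAL binder, C-R2);
  tail `ABC_of_cor312PerImage_content` (p461361);
* `abc_of_slotStatement_genuineM_szpiroBad` — the (P)-STATEMENT line at the M-level setting [hstPBad · hReadP] (M twin of p458998 §`abc_of_slotStatement…`).
Explicit 2 each = NUM-P 1 · READ-P-M 1 (→ 1 when abc-iut-C-cert-2's M-level slot READ lands: instantiate `hReadP`); CONE 0 · PIN 0 · SIDE 0 · PROV 0.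

WHAT IT BUYS / HONEST STRENGTH (numbers, not adjectives; as for the K twins): the M line — the genuine carriers `(V̲, K_{v̲})` of C-lead ruling C-R12 (e)
«target #2′» — gains its reading-(P) companion; the NUM-P-OFF binders are consumed at NO admissible `(P, l)` with `log q^{∤{2,l}}(λ) ≤ 120·d*_mod·l`
(`≥ 4.6·10⁸` nats; content form) resp. at no Szpiro-good one (Szpiro-bad form) — at no known or tabulated datum for the content form; where consumed they are
neither instantiated nor refuted; `SlotLicence` is a STRONGER-THAN-PRINT reading of Step (xi-f) (print: hull of the union of ALL possible images, p. 184
l. 26–29). HONEST FRAMING: locates / conditionally verifies; nothing here asserts that abc is proved or refuted, or that [IUTchIII] Cor. 3.12 / Thm. 3.11 or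
[IUTchIV] Thm. 1.10 holds or fails at any datum, or takes a side on any author (Mochizuki / Scholze–Stix / Joshi / Dupuy–Hilado) or on the (U)/(P) reading;
`hNumPOffBad` / `hNumPOffC` / `hstPBad` / `hReadP` are assumption labels, never asserted; a twin discharges nothing; typed ≠ proved; instantiated ≠ endorsed;
refuted-as-typed ≠ refuted-in-print. [claim: Mochizuki2012, status: disputed]
[cite: Mochizuki2012, IUTchIII Cor. 3.12 p. 173–174, Step (x) p. 181, Step (xi-f) p. 184; IUTchIV Thm. 1.10 p. 22–31, Cor. 2.2 (ii)–(iii) p. 43–47]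
[cite: Mochizuki2012, IUTchI Def. 3.1 (e) p. 62] [cite: DupuyHilado2025, §1 (1.1), §3.3–3.4, §3.9, §4.10–4.12]
-/

noncomputable section

open Set Function NumberField IsDedekindDomain

namespace Summit.ABC.IUTFork.Conditional

open Thm311 Thm311.Real Cor312 Cor312Vol Cor312Prov Literature.IUT.LogThetaLattice Literature.IUT.LogVolume
  Literature.IUT.HodgeTheaters Literature.IUT.LogVolume.ThetaData Literature.NumberTheory.NumberFields
open Literature.NumberTheory.DiophantineGeometry.GenEll Summit.ABC.ABC.Theorems

section Family

/-! ## §1 DATA — the M books' context binders of the summand-route M-level sharp setting (p453767 / p461893 VERBATIM, γ-relevant columns) -/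

variable
    (M : ∀ (P : NFPoint) (l : ℕ) (T : Cor22.ThetaVolumeDatumAt P l), Type) [∀ P l T, Field (M P l T)] [∀ P l T, NumberField (M P l T)]
    (archPk : ∀ (P : NFPoint) (l : ℕ) (T : Cor22.ThetaVolumeDatumAt P l), letI := T.instFieldF; letI := T.instNumberFieldF; letI := T.instAlgebraF; letI := T.instFieldK;
        letI := T.instNumberFieldK; letI := T.instAlgebraK; letI := T.instFieldFbar; letI := T.instAlgebraFbar;
        letI := T.instAlgebraKFbar; letI := T.instIsElliptic;
      ∀ (j : (thetaIndexOfInitial T.D).Label) (vQ : (thetaIndexOfInitial T.D).VQ), Set ((logShellsOfInitialDH T.D (analyticLogvVal T.K)).Packet j vQ))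
    (archSub : ∀ (P : NFPoint) (l : ℕ) (T : Cor22.ThetaVolumeDatumAt P l), letI := T.instFieldF; letI := T.instNumberFieldF; letI := T.instAlgebraF; letI := T.instFieldK;
        letI := T.instNumberFieldK; letI := T.instAlgebraK; letI := T.instFieldFbar; letI := T.instAlgebraFbar;
        letI := T.instAlgebraKFbar; letI := T.instIsElliptic;
      ∀ (j : (thetaIndexOfInitial T.D).Label) (v : (thetaIndexOfInitial T.D).V), Set ((logShellsOfInitialDH T.D (analyticLogvVal T.K)).Packet j ((thetaIndexOfInitial T.D).over v)))
    (Ψ : ∀ (P : NFPoint) (l : ℕ) (T : Cor22.ThetaVolumeDatumAt P l), letI := T.instFieldF; letI := T.instNumberFieldF; letI := T.instAlgebraF; letI := T.instFieldK;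
        letI := T.instNumberFieldK; letI := T.instAlgebraK; letI := T.instFieldFbar; letI := T.instAlgebraFbar;
        letI := T.instAlgebraKFbar; letI := T.instIsElliptic;
      ℤ → ∀ v : (thetaIndexOfInitial T.D).V, v ∈ (thetaIndexOfInitial T.D).Vbad → Set ((logShellsOfInitialDH T.D (analyticLogvVal T.K)).StarPacket v))
    (act : ∀ (P : NFPoint) (l : ℕ) (T : Cor22.ThetaVolumeDatumAt P l), letI := T.instFieldF; letI := T.instNumberFieldF; letI := T.instAlgebraF; letI := T.instFieldK;
        letI := T.instNumberFieldK; letI := T.instAlgebraK; letI := T.instFieldFbar; letI := T.instAlgebraFbar;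
        letI := T.instAlgebraKFbar; letI := T.instIsElliptic;
      ℤ → ∀ v : (thetaIndexOfInitial T.D).V, v ∈ (thetaIndexOfInitial T.D).Vbad → (logShellsOfInitialDH T.D (analyticLogvVal T.K)).StarPacket v → Module.End ℚ ((logShellsOfInitialDH T.D (analyticLogvVal T.K)).StarPacket v))
    (Mmod : ∀ (P : NFPoint) (l : ℕ) (T : Cor22.ThetaVolumeDatumAt P l), letI := T.instFieldF; letI := T.instNumberFieldF; letI := T.instAlgebraF; letI := T.instFieldK;
        letI := T.instNumberFieldK; letI := T.instAlgebraK; letI := T.instFieldFbar; letI := T.instAlgebraFbar;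
        letI := T.instAlgebraKFbar; letI := T.instIsElliptic;
      ℤ → ∀ j : (thetaIndexOfInitial T.D).LabelStar, Set ((logShellsOfInitialDH T.D (analyticLogvVal T.K)).GlobalPacket j.1))
    (region : ∀ (P : NFPoint) (l : ℕ) (T : Cor22.ThetaVolumeDatumAt P l), letI := T.instFieldF; letI := T.instNumberFieldF; letI := T.instAlgebraF; letI := T.instFieldK;
        letI := T.instNumberFieldK; letI := T.instAlgebraK; letI := T.instFieldFbar; letI := T.instAlgebraFbar;
        letI := T.instAlgebraKFbar; letI := T.instIsElliptic;
      ℤ → ∀ j : (thetaIndexOfInitial T.D).LabelStar, FinDivisor (M P l T) → ∀ vQ : (thetaIndexOfInitial T.D).VQ, Set ((logShellsOfInitialDH T.D (analyticLogvVal T.K)).Packet j.1 vQ))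
    (n : ∀ (P : NFPoint) (l : ℕ) (T : Cor22.ThetaVolumeDatumAt P l), ℤ)
    {HT : ∀ (P : NFPoint) (l : ℕ) (T : Cor22.ThetaVolumeDatumAt P l), Type} {LogLink : ∀ (P : NFPoint) (l : ℕ) (T : Cor22.ThetaVolumeDatumAt P l), HT P l T → HT P l T → Type}
    {IsFull : ∀ (P : NFPoint) (l : ℕ) (T : Cor22.ThetaVolumeDatumAt P l), ∀ {s t : HT P l T}, LogLink P l T s t → Prop}
    (lat : ∀ (P : NFPoint) (l : ℕ) (T : Cor22.ThetaVolumeDatumAt P l), LGPGaussianLogThetaLattice (LogLink P l T) (IsFull P l T))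
    {Frd : ∀ (P : NFPoint) (l : ℕ) (T : Cor22.ThetaVolumeDatumAt P l), Type} {IsoF : ∀ (P : NFPoint) (l : ℕ) (T : Cor22.ThetaVolumeDatumAt P l), Frd P l T → Frd P l T → Type} {Ob : ∀ (P : NFPoint) (l : ℕ) (T : Cor22.ThetaVolumeDatumAt P l), Frd P l T → Type}
    {realify : ∀ (P : NFPoint) (l : ℕ) (T : Cor22.ThetaVolumeDatumAt P l), Frd P l T → Frd P l T} {Strip : ∀ (P : NFPoint) (l : ℕ) (T : Cor22.ThetaVolumeDatumAt P l), Type} {IsoS : ∀ (P : NFPoint) (l : ℕ) (T : Cor22.ThetaVolumeDatumAt P l), Strip P l T → Strip P l T → Type}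
    {Mv : ∀ (P : NFPoint) (l : ℕ) (T : Cor22.ThetaVolumeDatumAt P l), letI := T.instFieldF; letI := T.instNumberFieldF; letI := T.instAlgebraF; letI := T.instFieldK;
        letI := T.instNumberFieldK; letI := T.instAlgebraK; letI := T.instFieldFbar; letI := T.instAlgebraFbar;
        letI := T.instAlgebraKFbar; letI := T.instIsElliptic;
      ∀ v : (thetaIndexOfInitial T.D).V, v ∈ (thetaIndexOfInitial T.D).Vbad → Type}
    [∀ P l T v h, Monoid (Mv P l T v h)]
    (sig : ∀ (P : NFPoint) (l : ℕ) (T : Cor22.ThetaVolumeDatumAt P l), letI := T.instFieldF; letI := T.instNumberFieldF; letI := T.instAlgebraF; letI := T.instFieldK;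
        letI := T.instNumberFieldK; letI := T.instAlgebraK; letI := T.instFieldFbar; letI := T.instAlgebraFbar;
        letI := T.instAlgebraKFbar; letI := T.instIsElliptic;
      GlobalLGPFrobenioidSignature (thetaIndexOfInitial T.D).lstar (thetaIndexOfInitial T.D).V (· ∈ (thetaIndexOfInitial T.D).Vbad) (Frd P l T) (IsoF P l T) (Ob P l T) (realify P l T)
        (Strip P l T) (IsoS P l T) (Mv P l T))
    (split : ∀ (P : NFPoint) (l : ℕ) (T : Cor22.ThetaVolumeDatumAt P l), SplittingMonoids (Mv P l T))
    {ObΔ : ∀ (P : NFPoint) (l : ℕ) (T : Cor22.ThetaVolumeDatumAt P l), Type}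
    {N : ∀ (P : NFPoint) (l : ℕ) (T : Cor22.ThetaVolumeDatumAt P l), letI := T.instFieldF; letI := T.instNumberFieldF; letI := T.instAlgebraF; letI := T.instFieldK;
        letI := T.instNumberFieldK; letI := T.instAlgebraK; letI := T.instFieldFbar; letI := T.instAlgebraFbar;
        letI := T.instAlgebraKFbar; letI := T.instIsElliptic;
      ∀ v : (thetaIndexOfInitial T.D).V, v ∈ (thetaIndexOfInitial T.D).Vbad → Type}
    [∀ P l T v h, Monoid (N P l T v h)] (qData : ∀ (P : NFPoint) (l : ℕ) (T : Cor22.ThetaVolumeDatumAt P l), QPilotData (ObΔ P l T) (N P l T))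

/-! ## §2 Per datum at the M-level setting, reading (P) -/

/-- **Per datum, reading (P), M level: `SlotStatement` + the READ-P-M bound ⟹ `T.Cor312PerImageOf`** at the summand-route M-level sharp setting of the
datum's OWN ideles (q-side: abc-iut-w5-d244's theorem `negLogQ_settingPrVolSharpM_ideleDataOf_eq_negAbsLogQ` — `−|log(q)|` of the setting IS
`T.I.negAbsLogQ`; no provenance binder). Nothing asserted. [cite: Mochizuki2012, IUTchIV Thm. 1.10 p. 23] [cite: DupuyHilado2025, §3.3, Thm. 3.10.1]
[claim: Mochizuki2012, status: disputed] -/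
theorem GenuineMSlot.cor312PerImageOf_of_slotStatement {P : NFPoint} {l : ℕ} (T : Cor22.ThetaVolumeDatumAt P l)
    (hst : letI := T.instFieldF; letI := T.instNumberFieldF; letI := T.instAlgebraF; letI := T.instFieldK;
        letI := T.instNumberFieldK; letI := T.instAlgebraK; letI := T.instFieldFbar; letI := T.instAlgebraFbar;
        letI := T.instAlgebraKFbar; letI := T.instIsElliptic;
      (settingPrVolSharpM T.D (logvAnalyticVal_analyticLogvVal (K := T.K)) (tOfIdeleData T.D (ideleDataOf T.D T.isVolumeInputOf))
          (fun u x => tqM T.D (ratChar u) u (natCast_ratChar_mem u) (ideleDataOf T.D T.isVolumeInputOf) x)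
          (M P l T) (archPk P l T) (archSub P l T) (Ψ P l T) (act P l T)
          (Mmod P l T) (region P l T) (n P l T) (lat P l T) (sig P l T) (split P l T) (qData P l T)
          (fun u x => tqM_ne_zero T.D (ratChar u) u (natCast_ratChar_mem u) (ideleDataOf T.D T.isVolumeInputOf) x)
          (GenuineM.finite_ratPlaces_under_S T.D).toFinset
          (fun u x hu => norm_tqM_eq_one_of_not_mem T.D (ratChar u) u (natCast_ratChar_mem u) (ideleDataOf T.D T.isVolumeInputOf) x
            fun hx => hu ((Set.Finite.mem_toFinset _).mpr ⟨x, hx⟩))).SlotStatement)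
    (hread : letI := T.instFieldF; letI := T.instNumberFieldF; letI := T.instAlgebraF; letI := T.instFieldK;
        letI := T.instNumberFieldK; letI := T.instAlgebraK; letI := T.instFieldFbar; letI := T.instAlgebraFbar;
        letI := T.instAlgebraKFbar; letI := T.instIsElliptic;
      (settingPrVolSharpM T.D (logvAnalyticVal_analyticLogvVal (K := T.K)) (tOfIdeleData T.D (ideleDataOf T.D T.isVolumeInputOf))
          (fun u x => tqM T.D (ratChar u) u (natCast_ratChar_mem u) (ideleDataOf T.D T.isVolumeInputOf) x)
          (M P l T) (archPk P l T) (archSub P l T) (Ψ P l T) (act P l T)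
          (Mmod P l T) (region P l T) (n P l T) (lat P l T) (sig P l T) (split P l T) (qData P l T)
          (fun u x => tqM_ne_zero T.D (ratChar u) u (natCast_ratChar_mem u) (ideleDataOf T.D T.isVolumeInputOf) x)
          (GenuineM.finite_ratPlaces_under_S T.D).toFinset
          (fun u x hu => norm_tqM_eq_one_of_not_mem T.D (ratChar u) u (natCast_ratChar_mem u) (ideleDataOf T.D T.isVolumeInputOf) x
            fun hx => hu ((Set.Finite.mem_toFinset _).mpr ⟨x, hx⟩))).negLogThetaSlot ≤ ((T.negLogThetaPerImage : ℝ) : WithTop ℝ)) :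
    T.Cor312PerImageOf := by
  letI := T.instFieldF; letI := T.instNumberFieldF; letI := T.instAlgebraF; letI := T.instFieldK
  letI := T.instNumberFieldK; letI := T.instAlgebraK; letI := T.instFieldFbar; letI := T.instAlgebraFbar
  letI := T.instAlgebraKFbar; letI := T.instIsElliptic
  have hle := WithTop.coe_le_coe.mp (hst.2.trans hread)
  rw [negLogQ_settingPrVolSharpM_ideleDataOf_eq_negAbsLogQ] at hle
  exact hle

/-- **Per datum, reading (P), M level: `SlotLicence` + the READ-P-M bound ⟹ `T.Cor312PerImageOf`** (monotone log-volume from abc-iut-s2-p8's THEOREM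
`bridgeHyps_settingPrVolSharpM_of_ideles` at the genuine Θ-ideles — non-zero, units off the rational places under `V^bad_mod` (abc-iut-w5-d033);
finiteness of `−|log(Θ)|_(P)` from the READ-P-M bound; then `Cor312.Setting.slotStatement_of_slotLicence`). Nothing asserted.
[cite: Mochizuki2012, IUTchIII Prop. 3.9 (ii) p. 126, Cor. 3.12 Step (xi-f) p. 184] [claim: Mochizuki2012, status: disputed] -/
theorem GenuineMSlot.cor312PerImageOf_of_slotLicence {P : NFPoint} {l : ℕ} (T : Cor22.ThetaVolumeDatumAt P l)
    (hlic : letI := T.instFieldF; letI := T.instNumberFieldF; letI := T.instAlgebraF; letI := T.instFieldK;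
        letI := T.instNumberFieldK; letI := T.instAlgebraK; letI := T.instFieldFbar; letI := T.instAlgebraFbar;
        letI := T.instAlgebraKFbar; letI := T.instIsElliptic;
      (settingPrVolSharpM T.D (logvAnalyticVal_analyticLogvVal (K := T.K)) (tOfIdeleData T.D (ideleDataOf T.D T.isVolumeInputOf))
          (fun u x => tqM T.D (ratChar u) u (natCast_ratChar_mem u) (ideleDataOf T.D T.isVolumeInputOf) x)
          (M P l T) (archPk P l T) (archSub P l T) (Ψ P l T) (act P l T)
          (Mmod P l T) (region P l T) (n P l T) (lat P l T) (sig P l T) (split P l T) (qData P l T)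
          (fun u x => tqM_ne_zero T.D (ratChar u) u (natCast_ratChar_mem u) (ideleDataOf T.D T.isVolumeInputOf) x)
          (GenuineM.finite_ratPlaces_under_S T.D).toFinset
          (fun u x hu => norm_tqM_eq_one_of_not_mem T.D (ratChar u) u (natCast_ratChar_mem u) (ideleDataOf T.D T.isVolumeInputOf) x
            fun hx => hu ((Set.Finite.mem_toFinset _).mpr ⟨x, hx⟩))).SlotLicence)
    (hread : letI := T.instFieldF; letI := T.instNumberFieldF; letI := T.instAlgebraF; letI := T.instFieldK;
        letI := T.instNumberFieldK; letI := T.instAlgebraK; letI := T.instFieldFbar; letI := T.instAlgebraFbar;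
        letI := T.instAlgebraKFbar; letI := T.instIsElliptic;
      (settingPrVolSharpM T.D (logvAnalyticVal_analyticLogvVal (K := T.K)) (tOfIdeleData T.D (ideleDataOf T.D T.isVolumeInputOf))
          (fun u x => tqM T.D (ratChar u) u (natCast_ratChar_mem u) (ideleDataOf T.D T.isVolumeInputOf) x)
          (M P l T) (archPk P l T) (archSub P l T) (Ψ P l T) (act P l T)
          (Mmod P l T) (region P l T) (n P l T) (lat P l T) (sig P l T) (split P l T) (qData P l T)
          (fun u x => tqM_ne_zero T.D (ratChar u) u (natCast_ratChar_mem u) (ideleDataOf T.D T.isVolumeInputOf) x)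
          (GenuineM.finite_ratPlaces_under_S T.D).toFinset
          (fun u x hu => norm_tqM_eq_one_of_not_mem T.D (ratChar u) u (natCast_ratChar_mem u) (ideleDataOf T.D T.isVolumeInputOf) x
            fun hx => hu ((Set.Finite.mem_toFinset _).mpr ⟨x, hx⟩))).negLogThetaSlot ≤ ((T.negLogThetaPerImage : ℝ) : WithTop ℝ)) :
    T.Cor312PerImageOf := by
  letI := T.instFieldF; letI := T.instNumberFieldF; letI := T.instAlgebraF; letI := T.instFieldK
  letI := T.instNumberFieldK; letI := T.instAlgebraK; letI := T.instFieldFbar; letI := T.instAlgebraFbar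
  letI := T.instAlgebraKFbar; letI := T.instIsElliptic
  refine GenuineMSlot.cor312PerImageOf_of_slotStatement M archPk archSub Ψ act Mmod region n lat sig split qData T ?_ hread
  have hfin : (settingPrVolSharpM T.D (logvAnalyticVal_analyticLogvVal (K := T.K)) (tOfIdeleData T.D (ideleDataOf T.D T.isVolumeInputOf))
          (fun u x => tqM T.D (ratChar u) u (natCast_ratChar_mem u) (ideleDataOf T.D T.isVolumeInputOf) x)
          (M P l T) (archPk P l T) (archSub P l T) (Ψ P l T) (act P l T)
          (Mmod P l T) (region P l T) (n P l T) (lat P l T) (sig P l T) (split P l T) (qData P l T)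
          (fun u x => tqM_ne_zero T.D (ratChar u) u (natCast_ratChar_mem u) (ideleDataOf T.D T.isVolumeInputOf) x)
          (GenuineM.finite_ratPlaces_under_S T.D).toFinset
          (fun u x hu => norm_tqM_eq_one_of_not_mem T.D (ratChar u) u (natCast_ratChar_mem u) (ideleDataOf T.D T.isVolumeInputOf) x
            fun hx => hu ((Set.Finite.mem_toFinset _).mpr ⟨x, hx⟩))).ThetaSlotFinite := by
    by_contra hnf
    have htop : (settingPrVolSharpM T.D (logvAnalyticVal_analyticLogvVal (K := T.K)) (tOfIdeleData T.D (ideleDataOf T.D T.isVolumeInputOf))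
          (fun u x => tqM T.D (ratChar u) u (natCast_ratChar_mem u) (ideleDataOf T.D T.isVolumeInputOf) x)
          (M P l T) (archPk P l T) (archSub P l T) (Ψ P l T) (act P l T)
          (Mmod P l T) (region P l T) (n P l T) (lat P l T) (sig P l T) (split P l T) (qData P l T)
          (fun u x => tqM_ne_zero T.D (ratChar u) u (natCast_ratChar_mem u) (ideleDataOf T.D T.isVolumeInputOf) x)
          (GenuineM.finite_ratPlaces_under_S T.D).toFinset
          (fun u x hu => norm_tqM_eq_one_of_not_mem T.D (ratChar u) u (natCast_ratChar_mem u) (ideleDataOf T.D T.isVolumeInputOf) x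
            fun hx => hu ((Set.Finite.mem_toFinset _).mpr ⟨x, hx⟩))).negLogThetaSlot = ⊤ := by
      unfold Cor312.Setting.negLogThetaSlot; rw [if_neg hnf]
    rw [htop] at hread
    exact absurd hread (by simp)
  exact Cor312.Setting.slotStatement_of_slotLicence _
    (bridgeHyps_settingPrVolSharpM_of_ideles T.D (logvAnalyticVal_analyticLogvVal (K := T.K)) (tOfIdeleData T.D (ideleDataOf T.D T.isVolumeInputOf))
      (fun u x => tqM T.D (ratChar u) u (natCast_ratChar_mem u) (ideleDataOf T.D T.isVolumeInputOf) x)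
      (M P l T) (archPk P l T) (archSub P l T) (Ψ P l T) (act P l T) (Mmod P l T) (region P l T) (n P l T) (lat P l T) (sig P l T) (split P l T) (qData P l T)
      (fun u x => tqM_ne_zero T.D (ratChar u) u (natCast_ratChar_mem u) (ideleDataOf T.D T.isVolumeInputOf) x)
      (GenuineM.finite_ratPlaces_under_S T.D).toFinset
      (fun u x hu => norm_tqM_eq_one_of_not_mem T.D (ratChar u) u (natCast_ratChar_mem u) (ideleDataOf T.D T.isVolumeInputOf) x
        fun hx => hu ((Set.Finite.mem_toFinset _).mpr ⟨x, hx⟩))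
      (fun u i x => tThetaM_ne_zero T.D (ratChar u) u (natCast_ratChar_mem u) (ideleDataOf T.D T.isVolumeInputOf) i x)
      (GenuineM.finite_ratPlaces_under_S T.D).toFinset
      (fun u i x hu => norm_tThetaM_eq_one_of_not_mem T.D (ratChar u) u (natCast_ratChar_mem u) (ideleDataOf T.D T.isVolumeInputOf) i x
        fun hx => hu ((Set.Finite.mem_toFinset _).mpr ⟨x, hx⟩))).mono
    hfin hlic

/-! ## §3 The γ certificates of the M line -/

/-- **`abc_of_slotLicence_orNumP_M_szpiroBad`** (the γ certificate of the M line, reading (P)) — `ABC` from: [NUM-P-OFF-M, Szpiro-bad] `hNumPOffBad` «at every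
admissible SZPIRO-BAD `(P, l)` and genuine `T` where OUR SLOT licence fails (summand-route M-level sharp setting of the datum's own ideles),
`T.Cor312PerImageOf`» · [READ-P-M] `hReadP` «`negLogThetaSlot ≤ ↑T.negLogThetaPerImage` at every genuine `T`» (to be discharged by abc-iut-C-cert-2's M-level slot
READ). M twin of p458998; per `(P, l)` its body verbatim. Explicit 2 → 1; CONE 0 · PIN 0 · SIDE 0 · PROV 0. «`ABC` follows from these hypotheses as typed» — no side
taken on [IUTchIII] Cor. 3.12, [IUTchIV] Thm. 1.10 or on the (U)/(P) reading; typed ≠ proved; instantiated ≠ endorsed. [claim: Mochizuki2012, status: disputed]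
[cite: DupuyHilado2025, §4.12] -/
theorem abc_of_slotLicence_orNumP_M_szpiroBad
    (hNumPOffBad : ∀ (P : NFPoint), P ∈ UP → ∀ (l : ℕ), l.Prime → 5 ≤ l →
      Cor22.AdmitsCore P → Cor22.CondP2 P l → Cor22.CondP5 P l → Cor22.CondP6 P l →
      (((l : ℝ) + 5) / 4 < (Cor22.dmod P : ℝ) ∨
        6 * l * (((l : ℝ) + 5) - 4 * Cor22.dmod P) / (((l : ℝ) + 4) * ((l : ℝ) - 3))
            * (P.logDiff + (1 - 1 / (l : ℝ)) * Cor22.logCondAvoid P {2, l})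
          + 6 * l * ((l : ℝ) + 5) / (((l : ℝ) + 4) * ((l : ℝ) - 3)) * Real.log Real.pi < Cor22.logQAvoid P {2, l}) →
      ∀ (T : Cor22.ThetaVolumeDatumAt P l), letI := T.instFieldF; letI := T.instNumberFieldF; letI := T.instAlgebraF; letI := T.instFieldK;
        letI := T.instNumberFieldK; letI := T.instAlgebraK; letI := T.instFieldFbar; letI := T.instAlgebraFbar;
        letI := T.instAlgebraKFbar; letI := T.instIsElliptic;
      ¬ (settingPrVolSharpM T.D (logvAnalyticVal_analyticLogvVal (K := T.K)) (tOfIdeleData T.D (ideleDataOf T.D T.isVolumeInputOf))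
          (fun u x => tqM T.D (ratChar u) u (natCast_ratChar_mem u) (ideleDataOf T.D T.isVolumeInputOf) x)
          (M P l T) (archPk P l T) (archSub P l T) (Ψ P l T) (act P l T)
          (Mmod P l T) (region P l T) (n P l T) (lat P l T) (sig P l T) (split P l T) (qData P l T)
          (fun u x => tqM_ne_zero T.D (ratChar u) u (natCast_ratChar_mem u) (ideleDataOf T.D T.isVolumeInputOf) x)
          (GenuineM.finite_ratPlaces_under_S T.D).toFinset
          (fun u x hu => norm_tqM_eq_one_of_not_mem T.D (ratChar u) u (natCast_ratChar_mem u) (ideleDataOf T.D T.isVolumeInputOf) x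
            fun hx => hu ((Set.Finite.mem_toFinset _).mpr ⟨x, hx⟩))).SlotLicence → T.Cor312PerImageOf)
    (hReadP : ∀ (P : NFPoint) (l : ℕ) (T : Cor22.ThetaVolumeDatumAt P l), letI := T.instFieldF; letI := T.instNumberFieldF; letI := T.instAlgebraF; letI := T.instFieldK;
        letI := T.instNumberFieldK; letI := T.instAlgebraK; letI := T.instFieldFbar; letI := T.instAlgebraFbar;
        letI := T.instAlgebraKFbar; letI := T.instIsElliptic;
      (settingPrVolSharpM T.D (logvAnalyticVal_analyticLogvVal (K := T.K)) (tOfIdeleData T.D (ideleDataOf T.D T.isVolumeInputOf))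
          (fun u x => tqM T.D (ratChar u) u (natCast_ratChar_mem u) (ideleDataOf T.D T.isVolumeInputOf) x)
          (M P l T) (archPk P l T) (archSub P l T) (Ψ P l T) (act P l T)
          (Mmod P l T) (region P l T) (n P l T) (lat P l T) (sig P l T) (split P l T) (qData P l T)
          (fun u x => tqM_ne_zero T.D (ratChar u) u (natCast_ratChar_mem u) (ideleDataOf T.D T.isVolumeInputOf) x)
          (GenuineM.finite_ratPlaces_under_S T.D).toFinset
          (fun u x hu => norm_tqM_eq_one_of_not_mem T.D (ratChar u) u (natCast_ratChar_mem u) (ideleDataOf T.D T.isVolumeInputOf) x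
            fun hx => hu ((Set.Finite.mem_toFinset _).mpr ⟨x, hx⟩))).negLogThetaSlot ≤ ((T.negLogThetaPerImage : ℝ) : WithTop ℝ))
    : _root_.ABC := by
  refine ABC_of_cor312PerImage fun P hP l hl h5 hc h2 h5' h6 T => ?_
  refine Cor22.forall_cor312PerImageOf_of_szpiroBad hP.1 h5 (fun _ => True) (fun hbad T' _ => ?_) T trivial
  letI := T'.instFieldF; letI := T'.instNumberFieldF; letI := T'.instAlgebraF; letI := T'.instFieldK
  letI := T'.instNumberFieldK; letI := T'.instAlgebraK; letI := T'.instFieldFbar; letI := T'.instAlgebraFbar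
  letI := T'.instAlgebraKFbar; letI := T'.instIsElliptic
  by_cases hlic : (settingPrVolSharpM T'.D (logvAnalyticVal_analyticLogvVal (K := T'.K)) (tOfIdeleData T'.D (ideleDataOf T'.D T'.isVolumeInputOf))
          (fun u x => tqM T'.D (ratChar u) u (natCast_ratChar_mem u) (ideleDataOf T'.D T'.isVolumeInputOf) x)
          (M P l T') (archPk P l T') (archSub P l T') (Ψ P l T') (act P l T')
          (Mmod P l T') (region P l T') (n P l T') (lat P l T') (sig P l T') (split P l T') (qData P l T')
          (fun u x => tqM_ne_zero T'.D (ratChar u) u (natCast_ratChar_mem u) (ideleDataOf T'.D T'.isVolumeInputOf) x)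
          (GenuineM.finite_ratPlaces_under_S T'.D).toFinset
          (fun u x hu => norm_tqM_eq_one_of_not_mem T'.D (ratChar u) u (natCast_ratChar_mem u) (ideleDataOf T'.D T'.isVolumeInputOf) x
            fun hx => hu ((Set.Finite.mem_toFinset _).mpr ⟨x, hx⟩))).SlotLicence
  · exact GenuineMSlot.cor312PerImageOf_of_slotLicence M archPk archSub Ψ act Mmod region n lat sig split qData T' hlic (hReadP P l T')
  · exact hNumPOffBad P hP l hl h5 hc h2 h5' h6 hbad T' hlic

/-- **`abc_of_slotLicence_orNumP_M_content`** (the γ certificate of the M line, θ-cut) — `ABC` from: [NUM-P-OFF-M, content] `hNumPOffC` «at every admissible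
`(P, l)` ON THE CONTENT LOCUS of [IUTchIV] Thm. 1.10's display and every genuine `T` where OUR SLOT licence fails (M-level setting), `T.Cor312PerImageOf`» ·
[READ-P-M] `hReadP`. M twin of p461361 (`abc_of_slotLicence_orNumP_K_content`); the Szpiro-bad antecedent REPLACED by the content guard (implies it:
`szpiroBad_of_content`), so the binder is WEAKER-OR-EQUAL than `hNumPOffBad` (C-R2); tail `ABC_of_cor312PerImage_content`. Explicit 2 → 1; CONE 0 · PIN 0 ·
SIDE 0 · PROV 0; off the content locus — in particular at every point with `log q^{∤{2,l}}(λ) ≤ 120·d*_mod·l`, hence at every known point — the NUM-P-OFF-M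
binder is not consumed. «`ABC` follows from these hypotheses as typed» — no side taken; typed ≠ proved; instantiated ≠ endorsed. [claim: Mochizuki2012, status: disputed]
[cite: Mochizuki2012, IUTchIV Thm. 1.10 p. 22–23, Step (viii) p. 30] [cite: DupuyHilado2025, §4.12] -/
theorem abc_of_slotLicence_orNumP_M_content
    (hNumPOffC : ∀ (P : NFPoint), P ∈ UP → ∀ (l : ℕ), l.Prime → 5 ≤ l →
      Cor22.AdmitsCore P → Cor22.CondP2 P l → Cor22.CondP5 P l → Cor22.CondP6 P l →
      6 * ((1 + 20 * (Cor22.dmod P : ℝ) / l) * (P.logDiff + Cor22.logCondAvoid P {2, l}))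
          + 120 * (2 ^ 12 * 3 ^ 3 * 5 * (Cor22.dmod P : ℝ) * l) < Cor22.logQAvoid P {2, l} →
      ∀ (T : Cor22.ThetaVolumeDatumAt P l), letI := T.instFieldF; letI := T.instNumberFieldF; letI := T.instAlgebraF; letI := T.instFieldK;
        letI := T.instNumberFieldK; letI := T.instAlgebraK; letI := T.instFieldFbar; letI := T.instAlgebraFbar;
        letI := T.instAlgebraKFbar; letI := T.instIsElliptic;
      ¬ (settingPrVolSharpM T.D (logvAnalyticVal_analyticLogvVal (K := T.K)) (tOfIdeleData T.D (ideleDataOf T.D T.isVolumeInputOf))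
          (fun u x => tqM T.D (ratChar u) u (natCast_ratChar_mem u) (ideleDataOf T.D T.isVolumeInputOf) x)
          (M P l T) (archPk P l T) (archSub P l T) (Ψ P l T) (act P l T)
          (Mmod P l T) (region P l T) (n P l T) (lat P l T) (sig P l T) (split P l T) (qData P l T)
          (fun u x => tqM_ne_zero T.D (ratChar u) u (natCast_ratChar_mem u) (ideleDataOf T.D T.isVolumeInputOf) x)
          (GenuineM.finite_ratPlaces_under_S T.D).toFinset
          (fun u x hu => norm_tqM_eq_one_of_not_mem T.D (ratChar u) u (natCast_ratChar_mem u) (ideleDataOf T.D T.isVolumeInputOf) x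
            fun hx => hu ((Set.Finite.mem_toFinset _).mpr ⟨x, hx⟩))).SlotLicence → T.Cor312PerImageOf)
    (hReadP : ∀ (P : NFPoint) (l : ℕ) (T : Cor22.ThetaVolumeDatumAt P l), letI := T.instFieldF; letI := T.instNumberFieldF; letI := T.instAlgebraF; letI := T.instFieldK;
        letI := T.instNumberFieldK; letI := T.instAlgebraK; letI := T.instFieldFbar; letI := T.instAlgebraFbar;
        letI := T.instAlgebraKFbar; letI := T.instIsElliptic;
      (settingPrVolSharpM T.D (logvAnalyticVal_analyticLogvVal (K := T.K)) (tOfIdeleData T.D (ideleDataOf T.D T.isVolumeInputOf))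
          (fun u x => tqM T.D (ratChar u) u (natCast_ratChar_mem u) (ideleDataOf T.D T.isVolumeInputOf) x)
          (M P l T) (archPk P l T) (archSub P l T) (Ψ P l T) (act P l T)
          (Mmod P l T) (region P l T) (n P l T) (lat P l T) (sig P l T) (split P l T) (qData P l T)
          (fun u x => tqM_ne_zero T.D (ratChar u) u (natCast_ratChar_mem u) (ideleDataOf T.D T.isVolumeInputOf) x)
          (GenuineM.finite_ratPlaces_under_S T.D).toFinset
          (fun u x hu => norm_tqM_eq_one_of_not_mem T.D (ratChar u) u (natCast_ratChar_mem u) (ideleDataOf T.D T.isVolumeInputOf) x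
            fun hx => hu ((Set.Finite.mem_toFinset _).mpr ⟨x, hx⟩))).negLogThetaSlot ≤ ((T.negLogThetaPerImage : ℝ) : WithTop ℝ))
    : _root_.ABC := by
  refine ABC_of_cor312PerImage_content fun P hP l hl h5 hc h2 h5' h6 hct T' => ?_
  letI := T'.instFieldF; letI := T'.instNumberFieldF; letI := T'.instAlgebraF; letI := T'.instFieldK
  letI := T'.instNumberFieldK; letI := T'.instAlgebraK; letI := T'.instFieldFbar; letI := T'.instAlgebraFbar
  letI := T'.instAlgebraKFbar; letI := T'.instIsElliptic
  by_cases hlic : (settingPrVolSharpM T'.D (logvAnalyticVal_analyticLogvVal (K := T'.K)) (tOfIdeleData T'.D (ideleDataOf T'.D T'.isVolumeInputOf))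
          (fun u x => tqM T'.D (ratChar u) u (natCast_ratChar_mem u) (ideleDataOf T'.D T'.isVolumeInputOf) x)
          (M P l T') (archPk P l T') (archSub P l T') (Ψ P l T') (act P l T')
          (Mmod P l T') (region P l T') (n P l T') (lat P l T') (sig P l T') (split P l T') (qData P l T')
          (fun u x => tqM_ne_zero T'.D (ratChar u) u (natCast_ratChar_mem u) (ideleDataOf T'.D T'.isVolumeInputOf) x)
          (GenuineM.finite_ratPlaces_under_S T'.D).toFinset
          (fun u x hu => norm_tqM_eq_one_of_not_mem T'.D (ratChar u) u (natCast_ratChar_mem u) (ideleDataOf T'.D T'.isVolumeInputOf) x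
            fun hx => hu ((Set.Finite.mem_toFinset _).mpr ⟨x, hx⟩))).SlotLicence
  · exact GenuineMSlot.cor312PerImageOf_of_slotLicence M archPk archSub Ψ act Mmod region n lat sig split qData T' hlic (hReadP P l T')
  · exact hNumPOffC P hP l hl h5 hc h2 h5' h6 hct T' hlic

/-- **`abc_of_slotStatement_genuineM_szpiroBad`** (the reading-(P) DOWNSTREAM statement line of the M books; M twin of p458998's
`abc_of_slotStatement_genuineK_szpiroBad`) — `ABC` from: [C312-P-M, Szpiro-bad] `hstPBad` «the typed Cor. 3.12 conclusion IN READING (P) (`SlotStatement`) of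
the summand-route M-level sharp setting of the datum's own ideles, at every admissible SZPIRO-BAD `(P, l)` and genuine `T`» · [READ-P-M] `hReadP`. Explicit 2 → 1;
CONE 0 · PROV 0. «`ABC` follows from these hypotheses as typed» — nothing asserted about either; no side taken on [IUTchIII] Cor. 3.12 or on (U)/(P); typed ≠
proved. [claim: Mochizuki2012, status: disputed] [cite: Mochizuki2012, IUTchIII Cor. 3.12 p. 174] -/
theorem abc_of_slotStatement_genuineM_szpiroBad
    (hstPBad : ∀ (P : NFPoint), P ∈ UP → ∀ (l : ℕ), l.Prime → 5 ≤ l →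
      Cor22.AdmitsCore P → Cor22.CondP2 P l → Cor22.CondP5 P l → Cor22.CondP6 P l →
      (((l : ℝ) + 5) / 4 < (Cor22.dmod P : ℝ) ∨
        6 * l * (((l : ℝ) + 5) - 4 * Cor22.dmod P) / (((l : ℝ) + 4) * ((l : ℝ) - 3))
            * (P.logDiff + (1 - 1 / (l : ℝ)) * Cor22.logCondAvoid P {2, l})
          + 6 * l * ((l : ℝ) + 5) / (((l : ℝ) + 4) * ((l : ℝ) - 3)) * Real.log Real.pi < Cor22.logQAvoid P {2, l}) →
      ∀ (T : Cor22.ThetaVolumeDatumAt P l), letI := T.instFieldF; letI := T.instNumberFieldF; letI := T.instAlgebraF; letI := T.instFieldK;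
        letI := T.instNumberFieldK; letI := T.instAlgebraK; letI := T.instFieldFbar; letI := T.instAlgebraFbar;
        letI := T.instAlgebraKFbar; letI := T.instIsElliptic;
      (settingPrVolSharpM T.D (logvAnalyticVal_analyticLogvVal (K := T.K)) (tOfIdeleData T.D (ideleDataOf T.D T.isVolumeInputOf))
          (fun u x => tqM T.D (ratChar u) u (natCast_ratChar_mem u) (ideleDataOf T.D T.isVolumeInputOf) x)
          (M P l T) (archPk P l T) (archSub P l T) (Ψ P l T) (act P l T)
          (Mmod P l T) (region P l T) (n P l T) (lat P l T) (sig P l T) (split P l T) (qData P l T)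
          (fun u x => tqM_ne_zero T.D (ratChar u) u (natCast_ratChar_mem u) (ideleDataOf T.D T.isVolumeInputOf) x)
          (GenuineM.finite_ratPlaces_under_S T.D).toFinset
          (fun u x hu => norm_tqM_eq_one_of_not_mem T.D (ratChar u) u (natCast_ratChar_mem u) (ideleDataOf T.D T.isVolumeInputOf) x
            fun hx => hu ((Set.Finite.mem_toFinset _).mpr ⟨x, hx⟩))).SlotStatement)
    (hReadP : ∀ (P : NFPoint) (l : ℕ) (T : Cor22.ThetaVolumeDatumAt P l), letI := T.instFieldF; letI := T.instNumberFieldF; letI := T.instAlgebraF; letI := T.instFieldK;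
        letI := T.instNumberFieldK; letI := T.instAlgebraK; letI := T.instFieldFbar; letI := T.instAlgebraFbar;
        letI := T.instAlgebraKFbar; letI := T.instIsElliptic;
      (settingPrVolSharpM T.D (logvAnalyticVal_analyticLogvVal (K := T.K)) (tOfIdeleData T.D (ideleDataOf T.D T.isVolumeInputOf))
          (fun u x => tqM T.D (ratChar u) u (natCast_ratChar_mem u) (ideleDataOf T.D T.isVolumeInputOf) x)
          (M P l T) (archPk P l T) (archSub P l T) (Ψ P l T) (act P l T)
          (Mmod P l T) (region P l T) (n P l T) (lat P l T) (sig P l T) (split P l T) (qData P l T)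
          (fun u x => tqM_ne_zero T.D (ratChar u) u (natCast_ratChar_mem u) (ideleDataOf T.D T.isVolumeInputOf) x)
          (GenuineM.finite_ratPlaces_under_S T.D).toFinset
          (fun u x hu => norm_tqM_eq_one_of_not_mem T.D (ratChar u) u (natCast_ratChar_mem u) (ideleDataOf T.D T.isVolumeInputOf) x
            fun hx => hu ((Set.Finite.mem_toFinset _).mpr ⟨x, hx⟩))).negLogThetaSlot ≤ ((T.negLogThetaPerImage : ℝ) : WithTop ℝ))
    : _root_.ABC := by
  refine ABC_of_cor312PerImage fun P hP l hl h5 hc h2 h5' h6 T => ?_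
  exact Cor22.forall_cor312PerImageOf_of_szpiroBad hP.1 h5 (fun _ => True)
    (fun hbad T' _ => GenuineMSlot.cor312PerImageOf_of_slotStatement M archPk archSub Ψ act Mmod region n lat sig split qData T'
      (hstPBad P hP l hl h5 hc h2 h5' h6 hbad T') (hReadP P l T')) T trivial

end Family

end Summit.ABC.IUTFork.Conditional

end
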